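import Literature.Barriers.CriticalPhenomena.LaceExpansionIsingAboveFourNarrowProofs
import Literature.Barriers.CriticalPhenomena.LaceExpansionIsingAboveFourOpenFacts
import Literature.Probability.LatticeModels.TwoPointGradientEstimate
import Literature.Probability.LatticeModels.CriticalTwoPointDCPLower
import Literature.Probability.LatticeModels.IsingBubbleDivergence
import Literature.Probability.LatticeModels.SharpLengthDCPTorus
import Literature.Barriers.CriticalPhenomena.LaceExpansionIsingAboveFourProofsAudit
import Literature.Probability.LatticeModels.PlanarIsingCriticalMagnetization
import HarnessLib

/-!
# `LaceExpansionIsingAboveFourNarrow`: assembly from the named facts of the tree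

Barrier catalogue `Literature/Barriers/CriticalPhenomena/` (D-0021), bookkeeping and proof companion
of the corrected barrier

`LaceExpansionIsingAboveFourNarrow := (¬ NNIsing.BubbleCondition 3 ∧ ¬ NNIsing.BubbleCondition 4) ∧ SpreadOutIsing.Sakai2007_thm13_spreadOut`

(`LaceExpansionIsingAboveFour.lean`; (N1) = Duminil-Copin–Panis, CMP 406 (2025), Thm. 1.8,
(N2) = Sakai, CMP 272 (2007), Thm. 1.3, spread-out case). It joins lines of the tree that had not
been joined and records the exact trust base of the barrier:

* (N1) is, verbatim, the standalone named fact
  `Literature.Probability.LatticeModels.DuminilCopinPanis2025_bubbleDiagram_eq_top`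
  (`IsingBubbleDivergence.lean`): `duminilCopinPanis2025_bubbleDiagram_eq_top_iff`;
* hence `laceExpansionIsingAboveFourNarrow_iff_facts`: Narrow ↔ DCP 2025 Thm. 1.8 ∧ Sakai 2007
  Thm. 1.3 (SO), and `LaceExpansionIsingAboveFourNarrow_of_facts`;
* **(N1) from Duminil-Copin–Panis's Theorem 1.2 at `β_c` alone** —
  `NNIsing.not_bubbleCondition_of_reflectedGradient`,
  `DuminilCopinPanis2025_bubbleDiagram_eq_top_of_reflectedGradient`: the printed proof of
  Theorem 1.8 (§1.2, p. 7) from Theorem 1.2 (the reflected-current inequality, the tree's named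
  fact `dcp_reflectedGradient_lower`, `CriticalTwoPointDCPLower.lean`), the gradient estimate
  (1.11) — a THEOREM of the tree, `twoPointFree_criticalBeta_gradient_estimate`
  (`TwoPointGradientEstimate.lean`, reflection positivity) — and the Messager–Miracle-Solé
  inequalities, the analysis
  being `NNIsing.not_bubbleCondition_of_dcp` (`LaceExpansionIsingAboveFourNarrowProofs.lean`); the
  only work here is to match the two renderings of the sum of Theorem 1.2 (the fact's
  `dcpReflect`/`⟨σ_yσ_{𝓡_n y}⟩` against the proof file's `axisRefl`/`⟨σ₀σ_{y - 𝓡_n y}⟩`, by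
  translation invariance and evenness of the free state);
* **Narrow from the four named facts that remain open** —
  `LaceExpansionIsingAboveFourNarrow_of_open_facts :
    dcp_reflectedGradient_lower (d := 3) → dcp_reflectedGradient_lower (d := 4) →
    LiuSlade2026_thm22 → LiuSlade2024_thm12_critical → Sakai2007_prop31 → LaceExpansionIsingAboveFourNarrow`,
  (N2) being `Sakai2007_thm13_spreadOut_of_open_facts` (`LaceExpansionIsingAboveFourOpenFacts.lean`).

* **(N1) discharged (appended 2026-08-15)** — Theorem 1.2 at `β_c` is now a THEOREM of the tree
  (`DCPNearCritical.dcp_critical_holds`, `SharpLengthDCPTorus.lean`: Lemmas 2.3–2.5 of the source on the even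
  tori — `ReflectedCurrents.lean`, `CriticalTwoPointDCPLowerLemma25.lean` —, the sharp-length input (2.5), the
  infinite-volume limit along even tori, the symmetry over the `2d` directions and Lemma 2.4), hence so are
  Theorem 1.8 (`DuminilCopinPanis2025_bubbleDiagram_eq_top_of_dcp_critical_holds` below) and conjunct (N1):
  `NNIsing.not_bubbleCondition_three`, `NNIsing.not_bubbleCondition_four`, the unconditional
  classification `NNIsing.bubbleCondition_iff_five_le'` (`d ≥ 2`: the bubble condition holds iff `d ≥ 5`),
  and `laceExpansionIsingAboveFourNarrow_iff_thm13`: **Narrow ↔ Sakai 2007, Thm. 1.3 (SO)**, equivalently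
  Narrow ↔ the catalogued `LaceExpansionIsingAboveFour` (`laceExpansionIsingAboveFourNarrow_iff_barrier`);
  what remains open is (N2) alone: `LaceExpansionIsingAboveFourNarrow_of_three_open_facts :
    LiuSlade2026_thm22 → LiuSlade2024_thm12_critical → Sakai2007_prop31 → LaceExpansionIsingAboveFourNarrow`.

So the trust base of `LaceExpansionIsingAboveFourNarrow` was, when this file was first written, exactly: Duminil-Copin–Panis 2025,
Theorem 1.2 at `β = β_c` in `d = 3` and `d = 4` (reflected random currents; its switching lemma,
Lemma 2.3, is the tree's `tsum_switch_reflected`, `ReflectedCurrents.lean`); Liu–Slade's two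
Gaussian-deconvolution theorems; and Sakai's diagrammatic bounds (Prop. 3.1, with Sakai 2022).
Nothing is restated, no definition and no named fact is introduced (D-0026).

## References

* H. Duminil-Copin, R. Panis, *New lower bounds for the (near) critical Ising and φ⁴ models'
  two-point functions*, CMP 406 (2025), arXiv:2404.05700: Thms. 1.2, 1.3, 1.8, §1.2 (proof of
  Thm. 1.8), eq. (1.11) [DuminilCopinPanis2025LowerBounds].
* A. Sakai, *Lace expansion for the Ising model*, CMP 272 (2007) 283–344, arXiv:math-ph/0510093:
  Thm. 1.3, Props. 1.1, 3.1 [Sakai2007]; A. Sakai, CMP 392 (2022) [Sakai2022].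
* Y. Liu, G. Slade, arXiv:2310.07640, Thm. 2.2 [LiuSlade2026]; arXiv:2310.07635, Thm. 1.2
  [LiuSlade2024].
-/

noncomputable section

open Finset
open Literature.Probability.LatticeModels Literature.Probability.Percolation
open scoped BigOperators ENNReal

namespace Literature.Barriers.CriticalPhenomena

namespace NNIsing

variable {d : ℕ}

/-- The reflection `𝓡_n` of the named fact (`dcpReflect i n : x_i ↦ 2n - x_i`) is the proof file's
`axisRefl i (2n)`. [cite: DuminilCopinPanis2025LowerBounds, §1.1 (definition of 𝓡_n before Theorem 1.2)] -/
theorem dcpReflect_eq_axisRefl (i : Fin d) (n : ℤ) (x : Site d) :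
    dcpReflect i n x = axisRefl i (2 * n) x := by
  funext j
  rw [dcpReflect, Function.update_apply, axisRefl_apply]

/-- Translation invariance and evenness of the free state: `⟨σ_yσ_z⟩^f_β = ⟨σ₀σ_{y-z}⟩^f_β`
(`β ≥ 0`). [cite: FriedliVelenik2017, Exercise 3.16 with Thm. 3.17] -/
theorem freeExpect_spinPair_eq_twoPointFree_sub {β : ℝ} (hβ : 0 ≤ β) (y z : Site d) :
    freeExpect d β 0 (spinPair y z) = twoPointFree d β (y - z) := by
  have h1 : freeExpect d β 0 (spinPair y z) = twoPointFree d β (z - y) :=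
    freePair_eq_twoPointFree_sub hβ y z
  rw [h1, ← twoPointFree_abs_eq hβ (z - y), ← twoPointFree_abs_eq hβ (y - z)]
  congr 1
  funext j
  simp [abs_sub_comm]

/-- **Duminil-Copin–Panis 2025, Theorem 1.8 from Theorem 1.2 (at `β_c`), nearest-neighbour Ising
model on `ℤ^d`, `d ∈ {3, 4}`**: the reflected-current inequality of Theorem 1.2 at `β = β_c` (the
named fact `dcp_reflectedGradient_lower`) implies `B(β_c) = Σ_x ⟨σ₀σ_x⟩²_{β_c} = ∞`, i.e.
`¬ NNIsing.BubbleCondition d`. Printed proof (§1.2, p. 7): the gradient estimate (1.11)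
(`twoPointFree_criticalBeta_gradient_estimate`), the Messager–Miracle-Solé inequalities and two
Cauchy–Schwarz steps (`NNIsing.not_bubbleCondition_of_dcp`).
[cite: DuminilCopinPanis2025LowerBounds, Theorem 1.8 (proof, §1.2) with Theorem 1.2] -/
theorem not_bubbleCondition_of_reflectedGradient (hd : d = 3 ∨ d = 4)
    (h : dcp_reflectedGradient_lower (d := d)) : ¬ BubbleCondition d := by
  have hd3 : 3 ≤ d := by omega
  have hβ : 0 ≤ criticalBeta d := criticalBeta_nonneg d
  obtain ⟨c₀, hc₀, N₀, _hN₀, hmain⟩ := h hd3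
  refine not_bubbleCondition_of_dcp hd ⟨0, by omega⟩
    (fun x j hj => twoPointFree_criticalBeta_gradient_estimate hd3 _ x j hj)
    ⟨c₀, hc₀, N₀, fun n hn => (hmain n hn).trans_eq ?_⟩
  refine Finset.sum_congr rfl fun x _ => ?_
  rw [Finset.sum_filter]
  refine Finset.sum_congr rfl fun y _ => ?_
  split_ifs with hxy
  · rw [freeExpect_spinPair_eq_twoPointFree_sub hβ, dcpReflect_eq_axisRefl, dcpReflect_eq_axisRefl]
  · rfl

/-- (N1) on `ℤ³` from Theorem 1.2 at `β_c` in `d = 3` alone: `B(β_c) = Σ_x ⟨σ₀σ_x⟩²_{β_c} = ∞`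
in `[0, ∞]`. [cite: DuminilCopinPanis2025LowerBounds, Theorem 1.8 (proof, §1.2) with Theorem 1.2] -/
theorem bubbleDiagram_three_eq_top_of_reflectedGradient (h3 : dcp_reflectedGradient_lower (d := 3)) :
    bubbleDiagram 3 (criticalBeta 3) = ∞ :=
  not_lt_top_iff.1 (not_bubbleCondition_of_reflectedGradient (Or.inl rfl) h3)

end NNIsing

open SpreadOutIsing

/-- **(N1) is the standalone fact of `IsingBubbleDivergence.lean`**: Duminil-Copin–Panis's
Theorem 1.8, `B(β_c) = ∞` on `ℤ³` and `ℤ⁴`, unfolds to `¬ NNIsing.BubbleCondition 3 ∧ ¬ NNIsing.BubbleCondition 4`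
(`NNIsing.bubbleDiagram d (criticalBeta d)` is verbatim the sum there).
[cite: DuminilCopinPanis2025LowerBounds, Theorem 1.8] -/
theorem duminilCopinPanis2025_bubbleDiagram_eq_top_iff :
    DuminilCopinPanis2025_bubbleDiagram_eq_top ↔
      ¬ NNIsing.BubbleCondition 3 ∧ ¬ NNIsing.BubbleCondition 4 := by
  simp only [DuminilCopinPanis2025_bubbleDiagram_eq_top, NNIsing.BubbleCondition,
    NNIsing.bubbleDiagram, not_lt_top_iff]

/-- **Theorem 1.8 (both printed dimensions) from Theorem 1.2 at `β_c` in `d = 3` and `d = 4`.**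
[cite: DuminilCopinPanis2025LowerBounds, Theorem 1.8 (proof, §1.2) with Theorem 1.2] -/
theorem DuminilCopinPanis2025_bubbleDiagram_eq_top_of_reflectedGradient
    (h3 : dcp_reflectedGradient_lower (d := 3)) (h4 : dcp_reflectedGradient_lower (d := 4)) :
    DuminilCopinPanis2025_bubbleDiagram_eq_top :=
  duminilCopinPanis2025_bubbleDiagram_eq_top_iff.2
    ⟨NNIsing.not_bubbleCondition_of_reflectedGradient (Or.inl rfl) h3,
      NNIsing.not_bubbleCondition_of_reflectedGradient (Or.inr rfl) h4⟩

/-- **The corrected barrier is the conjunction of two named facts of the tree**: Duminil-Copin–Panis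
2025, Thm. 1.8 (`DuminilCopinPanis2025_bubbleDiagram_eq_top`) and Sakai 2007, Thm. 1.3 for the
spread-out model (`SpreadOutIsing.Sakai2007_thm13_spreadOut`).
[cite: DuminilCopinPanis2025LowerBounds, Theorem 1.8] [cite: Sakai2007, Theorem 1.3 (SO model)] -/
theorem laceExpansionIsingAboveFourNarrow_iff_facts :
    LaceExpansionIsingAboveFourNarrow ↔
      DuminilCopinPanis2025_bubbleDiagram_eq_top ∧ Sakai2007_thm13_spreadOut := by
  rw [laceExpansionIsingAboveFourNarrow_iff, duminilCopinPanis2025_bubbleDiagram_eq_top_iff]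

/-- `LaceExpansionIsingAboveFourNarrow` from its two named facts.
[cite: DuminilCopinPanis2025LowerBounds, Theorem 1.8] [cite: Sakai2007, Theorem 1.3 (SO model)] -/
theorem LaceExpansionIsingAboveFourNarrow_of_facts (h18 : DuminilCopinPanis2025_bubbleDiagram_eq_top)
    (h13 : Sakai2007_thm13_spreadOut) : LaceExpansionIsingAboveFourNarrow :=
  laceExpansionIsingAboveFourNarrow_iff_facts.2 ⟨h18, h13⟩

/-- **`LaceExpansionIsingAboveFourNarrow` from the four named facts that remain open**:
Duminil-Copin–Panis 2025, Thm. 1.2 at `β_c` in `d = 3` and in `d = 4` (reflected random currents);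
Liu–Slade 2026, Thm. 2.2 and Liu–Slade 2024, Thm. 1.2 (critical case) (Gaussian deconvolution);
Sakai 2007, Prop. 3.1 (diagrammatic bounds, with Sakai 2022). Everything else in the printed proofs
of (N1) (gradient estimate, Messager–Miracle-Solé, Cauchy–Schwarz, Cauchy condensation) and of (N2)
(Sakai's Prop. 1.1 by random currents, the limits of §3.1, Liu–Slade's Thm. 1.7 machinery) is a
theorem of the tree.
[cite: DuminilCopinPanis2025LowerBounds, Theorems 1.2 and 1.8]
[cite: Sakai2007, Theorem 1.3 (SO model) with Propositions 1.1, 3.1]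
[cite: LiuSlade2026, Theorem 2.2] [cite: LiuSlade2024, Theorem 1.2] -/
theorem LaceExpansionIsingAboveFourNarrow_of_open_facts
    (h3 : dcp_reflectedGradient_lower (d := 3)) (h4 : dcp_reflectedGradient_lower (d := 4))
    (h22 : LiuSlade2026_thm22) (h24 : LiuSlade2024_thm12_critical) (h31 : Sakai2007_prop31) :
    LaceExpansionIsingAboveFourNarrow :=
  LaceExpansionIsingAboveFourNarrow_of_facts
    (DuminilCopinPanis2025_bubbleDiagram_eq_top_of_reflectedGradient h3 h4)
    (Sakai2007_thm13_spreadOut_of_open_facts h22 h24 h31)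

/-- The old barrier too, from the same open facts (its bubble-condition conjuncts are theorems):
`LaceExpansionIsingAboveFour_of_open_facts` needs only the three analysis/expansion facts.
[cite: Sakai2007, §1.1 and Theorem 1.3] -/
theorem laceExpansionIsingAboveFour_and_narrow_of_open_facts
    (h3 : dcp_reflectedGradient_lower (d := 3)) (h4 : dcp_reflectedGradient_lower (d := 4))
    (h22 : LiuSlade2026_thm22) (h24 : LiuSlade2024_thm12_critical) (h31 : Sakai2007_prop31) :
    LaceExpansionIsingAboveFour ∧ LaceExpansionIsingAboveFourNarrow :=
  ⟨LaceExpansionIsingAboveFour_of_open_facts h22 h24 h31,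
    LaceExpansionIsingAboveFourNarrow_of_open_facts h3 h4 h22 h24 h31⟩

/-! ### After the discharge of Theorem 1.2 at `β_c`: conjunct (N1) is a theorem -/

namespace NNIsing

/-- **The bubble condition fails for the nearest-neighbour Ising model on `ℤ³`**: `B(β_c) = ∞`
(Duminil-Copin–Panis 2025, Theorem 1.8, `d = 3`), unconditionally — Theorem 1.2 at `β_c` is the
tree's theorem `DCPNearCritical.dcp_critical_holds` (`SharpLengthDCPTorus.lean`). [cite: DuminilCopinPanis2025LowerBounds, Theorem 1.8] -/
theorem not_bubbleCondition_three : ¬ BubbleCondition 3 :=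
  not_bubbleCondition_of_reflectedGradient (Or.inl rfl) DCPNearCritical.dcp_critical_holds.1

/-- **The bubble condition fails for the nearest-neighbour Ising model on `ℤ⁴`**: `B(β_c) = ∞`
(Duminil-Copin–Panis 2025, Theorem 1.8, `d = 4`), unconditionally. [cite: DuminilCopinPanis2025LowerBounds, Theorem 1.8] -/
theorem not_bubbleCondition_four : ¬ BubbleCondition 4 :=
  not_bubbleCondition_of_reflectedGradient (Or.inr rfl) DCPNearCritical.dcp_critical_holds.1

/-- `B(β_c) = Σ_x ⟨σ₀σ_x⟩²_{β_c} = ∞` on `ℤ³`, in `[0, ∞]`. [cite: DuminilCopinPanis2025LowerBounds, Theorem 1.8] -/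
theorem bubbleDiagram_criticalBeta_three_eq_top : bubbleDiagram 3 (criticalBeta 3) = ∞ :=
  not_lt_top_iff.1 not_bubbleCondition_three

/-- `B(β_c) = Σ_x ⟨σ₀σ_x⟩²_{β_c} = ∞` on `ℤ⁴`, in `[0, ∞]`. [cite: DuminilCopinPanis2025LowerBounds, Theorem 1.8 and Remark 1.9] -/
theorem bubbleDiagram_criticalBeta_four_eq_top : bubbleDiagram 4 (criticalBeta 4) = ∞ :=
  not_lt_top_iff.1 not_bubbleCondition_four

/-- **The bubble condition for the nearest-neighbour Ising model holds exactly in `d ≥ 5`** (among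
`d ≥ 2`), unconditionally: `d = 2` by Simon's lower bound (`bubbleCondition_two_iff_false`), `d = 3, 4`
by Duminil-Copin–Panis's Theorem 1.8 (`not_bubbleCondition_three/_four`), `d ≥ 5` by the infrared
bound (`bubbleCondition_of_five_le`). [cite: DuminilCopinPanis2025LowerBounds, Theorem 1.8 and §1 (d = 2)] [cite: DuminilCopinICM2022, §7.1] -/
theorem bubbleCondition_iff_five_le' {d : ℕ} (hd : 2 ≤ d) : BubbleCondition d ↔ 5 ≤ d := by
  rcases (show d = 2 ∨ 3 ≤ d by omega) with rfl | hd3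
  · rw [bubbleCondition_two_iff_false]
    exact ⟨False.elim, fun h => absurd h (by norm_num)⟩
  · exact bubbleCondition_iff_five_le not_bubbleCondition_three not_bubbleCondition_four hd3

end NNIsing

/-- **The corrected barrier is now equivalent to Sakai 2007, Theorem 1.3 (spread-out) alone**:
conjunct (N1) is a theorem of the tree. [cite: Sakai2007, Theorem 1.3 (SO model)] [cite: DuminilCopinPanis2025LowerBounds, Theorem 1.8] -/
theorem laceExpansionIsingAboveFourNarrow_iff_thm13 :
    LaceExpansionIsingAboveFourNarrow ↔ Sakai2007_thm13_spreadOut :=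
  ⟨fun h => h.2, fun h13 => ⟨⟨NNIsing.not_bubbleCondition_three, NNIsing.not_bubbleCondition_four⟩, h13⟩⟩

/-- `LaceExpansionIsingAboveFourNarrow` from Sakai's Theorem 1.3 (spread-out).
[cite: Sakai2007, Theorem 1.3 (SO model)] -/
theorem LaceExpansionIsingAboveFourNarrow_of_thm13 (h13 : Sakai2007_thm13_spreadOut) :
    LaceExpansionIsingAboveFourNarrow :=
  laceExpansionIsingAboveFourNarrow_iff_thm13.2 h13

/-- **Duminil-Copin–Panis 2025, Theorem 1.8, proved**: the standalone fact
`DuminilCopinPanis2025_bubbleDiagram_eq_top` (`B(β_c) = ∞` on `ℤ³` and on `ℤ⁴`, `IsingBubbleDivergence.lean`)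
follows from the tree's theorem `DCPNearCritical.dcp_critical_holds` (Theorem 1.2 at `β_c`) in `d = 3` and
`d = 4`. (Its `_holds`-named discharge is left to the seat holding that fact's claim; this is the same term.)
[cite: DuminilCopinPanis2025LowerBounds, Theorem 1.8 with Theorem 1.2] -/
theorem DuminilCopinPanis2025_bubbleDiagram_eq_top_of_dcp_critical_holds :
    DuminilCopinPanis2025_bubbleDiagram_eq_top :=
  DuminilCopinPanis2025_bubbleDiagram_eq_top_of_reflectedGradient
    DCPNearCritical.dcp_critical_holds.1 DCPNearCritical.dcp_critical_holds.1

/-- (N1) holds outright, so `LaceExpansionIsingAboveFourNarrow_of_facts` needs only its second argument.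
[cite: DuminilCopinPanis2025LowerBounds, Theorem 1.8] [cite: Sakai2007, Theorem 1.3 (SO model)] -/
theorem LaceExpansionIsingAboveFourNarrow_of_facts' (h13 : Sakai2007_thm13_spreadOut) :
    LaceExpansionIsingAboveFourNarrow :=
  LaceExpansionIsingAboveFourNarrow_of_facts DuminilCopinPanis2025_bubbleDiagram_eq_top_of_dcp_critical_holds h13

/-- **The corrected barrier and the catalogued one are equivalent** (both reduce to Sakai's
Theorem 1.3 (SO): the bubble-condition conjuncts (1), (1') of `LaceExpansionIsingAboveFour` are
theorems, and so is (N1)). [cite: Sakai2007, §1.1 and Theorem 1.3 (SO model)] [cite: DuminilCopinPanis2025LowerBounds, Theorem 1.8] -/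
theorem laceExpansionIsingAboveFourNarrow_iff_barrier :
    LaceExpansionIsingAboveFourNarrow ↔ LaceExpansionIsingAboveFour :=
  ⟨fun h => laceExpansionIsingAboveFour_of_narrow h,
    fun h => LaceExpansionIsingAboveFourNarrow.of_barrier h
      NNIsing.not_bubbleCondition_three NNIsing.not_bubbleCondition_four⟩

/-- **`LaceExpansionIsingAboveFourNarrow` from the three named facts that remain open** — all on the
(N2) side: Liu–Slade 2026, Thm. 2.2; Liu–Slade 2024, Thm. 1.2 (critical case); Sakai 2007, Prop. 3.1
(with Sakai 2022). [cite: Sakai2007, Theorem 1.3 (SO model) with Propositions 1.1, 3.1]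
[cite: LiuSlade2026, Theorem 2.2] [cite: LiuSlade2024, Theorem 1.2] -/
theorem LaceExpansionIsingAboveFourNarrow_of_three_open_facts
    (h22 : LiuSlade2026_thm22) (h24 : LiuSlade2024_thm12_critical) (h31 : Sakai2007_prop31) :
    LaceExpansionIsingAboveFourNarrow :=
  LaceExpansionIsingAboveFourNarrow_of_thm13 (Sakai2007_thm13_spreadOut_of_open_facts h22 h24 h31)

end Literature.Barriers.CriticalPhenomena

end
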